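import Literature.NumberTheory.Transcendental.GaGmSubgroups
import Literature.NumberTheory.Transcendental.PhilipponZeroEstimateLeibniz
import HarnessLib

/-!
# Philippon's zero estimate on `𝔾ₐ × 𝔾ₘ^n`: Prop. 3.8, Step 2 (transversal data at a coset)

Topic `Literature/NumberTheory/Transcendental`. Eleventh module of the inline discharge of
`Literature.NumberTheory.Transcendental.Philippon1986_GaGm`: Step 2 of D. Roy's proof of the
multiplicity estimate Prop. 3.8 (Nesterenko–Philippon (eds.), LNM 1752, Ch. 11, pp. 216–217) for
`G = 𝔾ₐ × 𝔾ₘ^n`, made explicit. Roy chooses local equations of the coset `𝒱 = σ·H₀` and tangent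
vectors `∂₁, …, ∂_s ∈ W` representing a basis of `(W + T_{H₀})/T_{H₀}` with
`∂ᵢ g_j ≡ δᵢⱼ (unit)` modulo `𝔭(𝒱)`. For an irreducible closed subgroup `H₀ = V × T_A`
(`GaGm.toConnAlgSubgroup`, `GaGmSubgroups.lean`) the equations are global polynomials: the additive
coordinate `X - x(σ)` when `V = 0`, and the character binomials `Y^{χ⁺} - χ(σ) Y^{χ⁻}`, `χ ∈ A`;
their derivatives in the direction `w = (w₀, v)` are `w₀` and `⟨χ, v⟩·Y^{χ⁺}` modulo `𝔭(𝒱)`, and the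
common kernel of these linear forms is the Lie algebra `GaGm.ConnAlgSubgroup.tangent`. PROVED:

* `exists_dual_family` — linear algebra: from a set `𝓛` of linear forms on a finite-dimensional
  space with common kernel `T`, one can pick `k ≤ dim V - dim T` forms `λ_j ∈ 𝓛` and vectors `vᵢ`
  with `λ_j(vᵢ) = δᵢⱼ`;
* `invDeriv_prod_X_pow`, `charBinomial`, `invDeriv_charBinomial_sub_mem` — the derivative
  computations;
* **`exists_transversal`** — for `H₀` irreducible closed, `σ ∈ G`, `W`, with
  `s = dim W - dim (W ∩ Lie H₀)`: vectors `w₁, …, w_s ∈ W` and polynomials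
  `g₁, …, g_s ∈ 𝔭 = 𝔍(σ·H₀)` in a common box `Box(c)` with `D_{wᵢ} g_j ∈ 𝔭` (`i ≠ j`) and
  `D_{wᵢ} gᵢ ∉ 𝔭` — the data `hg/hoff/hdiag` of `…Multiplicity.lean` / `…Independence.lean`.

## References

* Yu. V. Nesterenko, P. Philippon (eds.), *Introduction to Algebraic Independence Theory*,
  LNM 1752, Springer 2001, Ch. 11 (D. Roy), Prop. 3.8, Step 2 (pp. 216–217).
* P. Philippon, *Lemmes de zéros dans les groupes algébriques commutatifs*, Bull. Soc. Math.
  France 114 (1986), 355–383, Lemme 4.6.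
-/

noncomputable section

open MvPolynomial Module
open scoped Pointwise

namespace Literature.NumberTheory.Transcendental

namespace GaGm

variable {n : ℕ}

/-! ### Linear algebra: dual families extracted from a set of linear forms -/

/-- **Dual families.** Let `𝓛` be a set of linear forms on a finite-dimensional space `V` with
common kernel `T`. For every `k` with `k + dim T ≤ dim V` there are forms `λ₁, …, λ_k ∈ 𝓛` and
vectors `v₁, …, v_k` with `λ_j(vᵢ) = δᵢⱼ`. [folklore] -/
theorem exists_dual_family {V : Type*} [AddCommGroup V] [Module ℂ V] [FiniteDimensional ℂ V]
    (𝓛 : Set (V →ₗ[ℂ] ℂ)) (T : Submodule ℂ V) (hT : ∀ v, v ∈ T ↔ ∀ l ∈ 𝓛, l v = 0) :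
    ∀ k : ℕ, k + finrank ℂ T ≤ finrank ℂ V →
      ∃ (l : Fin k → (V →ₗ[ℂ] ℂ)) (v : Fin k → V), (∀ j, l j ∈ 𝓛) ∧
        ∀ i j, l j (v i) = if i = j then 1 else 0 := by
  intro k
  induction k with
  | zero => intro _; exact ⟨Fin.elim0, Fin.elim0, fun j => j.elim0, fun i => i.elim0⟩
  | succ k ih =>
    intro hk
    obtain ⟨l, v, hl, hlv⟩ := ih (by omega)
    -- the joint kernel of `l₁, …, l_k` is too big to be inside `T`
    set L : V →ₗ[ℂ] (Fin k → ℂ) := LinearMap.pi l with hL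
    have hker : finrank ℂ V ≤ finrank ℂ (LinearMap.ker L) + k := by
      have h1 := LinearMap.finrank_range_add_finrank_ker L
      have h2 : finrank ℂ (LinearMap.range L) ≤ k := by
        calc finrank ℂ (LinearMap.range L) ≤ finrank ℂ (Fin k → ℂ) := Submodule.finrank_le _
          _ = k := by simp
      omega
    have hex : ∃ l' ∈ 𝓛, ∃ u ∈ LinearMap.ker L, l' u ≠ 0 := by
      by_contra hcon
      push Not at hcon
      have hle : LinearMap.ker L ≤ T := fun u hu => (hT u).mpr fun l' hl' => hcon l' hl' u hu
      have := Submodule.finrank_mono hle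
      omega
    obtain ⟨l', hl', u, hu, hl'u⟩ := hex
    have huj : ∀ j, l j u = 0 := fun j => by
      have := LinearMap.mem_ker.mp hu
      rw [hL] at this
      exact congrFun this j
    set u' : V := (l' u)⁻¹ • u with hu'
    have hl'u' : l' u' = 1 := by rw [hu', map_smul, smul_eq_mul, inv_mul_cancel₀ hl'u]
    have hju' : ∀ j, l j u' = 0 := fun j => by rw [hu', map_smul, huj j, smul_zero]
    refine ⟨Fin.cons l' l, Fin.cons u' (fun i => v i - (l' (v i)) • u'), ?_, ?_⟩
    · intro j
      refine Fin.cases ?_ (fun j' => ?_) j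
      · simpa using hl'
      · simpa using hl j'
    · intro i j
      refine Fin.cases ?_ (fun i' => ?_) i <;> refine Fin.cases ?_ (fun j' => ?_) j
      · simp [hl'u']
      · simp [hju', (Fin.succ_ne_zero j').symm]
      · simp [map_sub, map_smul, hl'u', Fin.succ_ne_zero]
      · simp only [Fin.cons_succ, map_sub, map_smul, hju', smul_zero, sub_zero, hlv, Fin.succ_inj]

/-! ### Derivatives of the equations of a coset -/

/-- `D_w (∏ Y_j^{e_j}) = (∑ e_j v_j) · ∏ Y_j^{e_j}`. [folklore] -/
theorem invDeriv_prod_X_pow (w : ℂ × (Fin n → ℂ)) (e : Fin n → ℕ) :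
    invDeriv w (∏ j, (X j.succ : MvPolynomial (Fin (n + 1)) ℂ) ^ e j) =
      (∑ j, (e j : ℂ) * w.2 j) • ∏ j, (X j.succ : MvPolynomial (Fin (n + 1)) ℂ) ^ e j := by
  classical
  have key : ∀ S : Finset (Fin n), invDeriv w (∏ j ∈ S, (X j.succ : MvPolynomial (Fin (n + 1)) ℂ) ^ e j) =
      (∑ j ∈ S, (e j : ℂ) * w.2 j) • ∏ j ∈ S, (X j.succ : MvPolynomial (Fin (n + 1)) ℂ) ^ e j := by
    intro S
    induction S using Finset.induction_on with
    | empty => simp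
    | insert a S ha ih =>
      rw [Finset.prod_insert ha, Finset.sum_insert ha, Derivation.leibniz, ih, Derivation.leibniz_pow,
        invDeriv_X_succ, add_smul]
      simp only [smul_eq_mul, nsmul_eq_mul, MvPolynomial.smul_eq_C_mul, map_mul, map_natCast]
      rcases Nat.eq_zero_or_pos (e a) with h0 | hpos
      · simp [h0]
      · have hX : (X a.succ : MvPolynomial (Fin (n + 1)) ℂ) ^ e a =
            X a.succ ^ (e a - 1) * X a.succ := by
          rw [← pow_succ, Nat.sub_add_cancel hpos]
        rw [hX]
        ring
  exact key Finset.univ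

/-- The character binomial `Y^{χ⁺} - ζ·Y^{χ⁻}` whose zero set in `G` is `{y^χ = ζ}`
(`GaGm.evalAt_charPoly_eq_zero_iff`). [folklore] -/
def charBinomial (χ : Fin n → ℤ) (ζ : ℂ) : MvPolynomial (Fin (n + 1)) ℂ :=
  ∏ j, X j.succ ^ (χ j).toNat - C ζ * ∏ j, X j.succ ^ (-χ j).toNat

/-- The linear form `⟨χ, v⟩ = ∑ χ_j v_j` of a character on `Lie G = ℂ × ℂⁿ`. [folklore] -/
def charForm (χ : Fin n → ℤ) : (ℂ × (Fin n → ℂ)) →ₗ[ℂ] ℂ where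
  toFun w := ∑ j, (χ j : ℂ) * w.2 j
  map_add' w w' := by simp [mul_add, Finset.sum_add_distrib]
  map_smul' c w := by simp [Finset.mul_sum, mul_left_comm]

/-- Unfolding `charForm`. [folklore] -/
theorem charForm_apply (χ : Fin n → ℤ) (w : ℂ × (Fin n → ℂ)) : charForm χ w = ∑ j, (χ j : ℂ) * w.2 j := rfl

/-- **`D_w (Y^{χ⁺} - ζY^{χ⁻}) - ⟨χ, v⟩·Y^{χ⁺}` is a multiple of `Y^{χ⁺} - ζY^{χ⁻}`.** [folklore] -/
theorem invDeriv_charBinomial_sub_eq (w : ℂ × (Fin n → ℂ)) (χ : Fin n → ℤ) (ζ : ℂ) :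
    invDeriv w (charBinomial χ ζ) - charForm χ w • ∏ j, (X j.succ : MvPolynomial (Fin (n + 1)) ℂ) ^ (χ j).toNat =
      (∑ j, ((-χ j).toNat : ℂ) * w.2 j) • charBinomial χ ζ := by
  unfold charBinomial
  have e1 : C ζ * ∏ j, (X j.succ : MvPolynomial (Fin (n + 1)) ℂ) ^ (-χ j).toNat =
      ζ • ∏ j, (X j.succ : MvPolynomial (Fin (n + 1)) ℂ) ^ (-χ j).toNat := (MvPolynomial.smul_eq_C_mul _ ζ).symm
  rw [e1, map_sub, Derivation.map_smul, invDeriv_prod_X_pow, invDeriv_prod_X_pow, charForm_apply]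
  have hχ : ∀ j, (χ j : ℂ) = ((χ j).toNat : ℂ) - ((-χ j).toNat : ℂ) := fun j => by
    have h : ((χ j).toNat : ℤ) - ((-χ j).toNat : ℤ) = χ j := Int.toNat_sub_toNat_neg (χ j)
    have h2 : (χ j : ℂ) = ((((χ j).toNat : ℤ) - ((-χ j).toNat : ℤ) : ℤ) : ℂ) := by rw [h]
    rw [h2]
    push_cast
    ring
  simp only [hχ, sub_mul, Finset.sum_sub_distrib, MvPolynomial.smul_eq_C_mul, map_sub, map_sum, map_mul,
    map_natCast, smul_sub]
  ring

section Transversal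

variable (H₀ : Subgroup (GaGm n)) (hirr : IsIrred (H₀ : Set (GaGm n))) (σ : GaGm n)

/-- Points of the coset `σ·H₀`. [folklore] -/
theorem mem_smul_coset_iff {g : GaGm n} : g ∈ σ • (H₀ : Set (GaGm n)) ↔ ∃ h ∈ H₀, g = σ * h := by
  rw [Set.mem_smul_set]
  constructor
  · rintro ⟨h, hh, rfl⟩; exact ⟨h, hh, rfl⟩
  · rintro ⟨h, hh, rfl⟩; exact ⟨h, hh, rfl⟩

/-- A `Y`-monomial does not vanish on a coset. [folklore] -/
theorem prod_X_pow_notMem_vanishing (e : Fin n → ℕ) :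
    (∏ j, (X j.succ : MvPolynomial (Fin (n + 1)) ℂ) ^ e j) ∉ vanishing (σ • (H₀ : Set (GaGm n))) := by
  intro h
  have h1 := h σ ((mem_smul_coset_iff H₀ σ).mpr ⟨1, H₀.one_mem, by simp⟩)
  rw [evalAt_eq_eval] at h1
  simp only [map_prod, map_pow, MvPolynomial.eval_X, coord_succ] at h1
  exact (Finset.prod_ne_zero_iff.mpr fun j _ => pow_ne_zero _ (σ.2 j).ne_zero) h1

include hirr in
/-- The additive coordinate `X - x(σ)` vanishes on `σ·H₀` when `H₀` has trivial additive part.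
[folklore] -/
theorem X_sub_C_mem_vanishing (hadd : (toConnAlgSubgroup H₀ hirr).addPart = false) :
    (X 0 - C (Multiplicative.toAdd σ.1) : MvPolynomial (Fin (n + 1)) ℂ) ∈ vanishing (σ • (H₀ : Set (GaGm n))) := by
  intro g hg
  obtain ⟨h, hh, rfl⟩ := (mem_smul_coset_iff H₀ σ).mp hg
  have hh1 : h.1 = 1 := by
    have hmem : h ∈ (toConnAlgSubgroup H₀ hirr).toSubgroup := by rwa [toSubgroup_toConnAlgSubgroup]
    exact hmem.1 hadd
  rw [evalAt_eq_eval]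
  simp [coord_zero, hh1]

/-- The character binomial `Y^{χ⁺} - χ(σ) Y^{χ⁻}` vanishes on `σ·H₀` for `χ` trivial on `H₀`.
[folklore] -/
theorem charBinomial_mem_vanishing {χ : Fin n → ℤ} (hχ : χ ∈ charGroup (H₀ : Set (GaGm n))) :
    charBinomial χ ((∏ j, (σ.2 j) ^ (χ j) : ℂˣ) : ℂ) ∈ vanishing (σ • (H₀ : Set (GaGm n))) := by
  intro g hg
  obtain ⟨h, hh, rfl⟩ := (mem_smul_coset_iff H₀ σ).mp hg
  unfold charBinomial
  rw [evalAt_charPoly_eq_zero_iff]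
  have h1 : ∏ j, (h.2 j) ^ (χ j) = 1 := hχ h hh
  simp only [Prod.snd_mul, Pi.mul_apply, mul_zpow, Finset.prod_mul_distrib, h1, mul_one]

include hirr in
/-- **Prop. 3.8, Step 2: transversal data at a coset.** For an irreducible closed subgroup `H₀`,
`σ ∈ G` and a subspace `W` of `Lie G`, with `s = dim W - dim (W ∩ Lie H₀)`, there are
`w₁, …, w_s ∈ W` and `g₁, …, g_s ∈ 𝔭 = 𝔍(σ·H₀)`, all in one box `Box(c)`, with
`D_{wᵢ} g_j ∈ 𝔭` for `i ≠ j` and `D_{wᵢ} gᵢ ∉ 𝔭`.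
[cite: NesterenkoPhilippon2001, Ch. 11 Prop. 3.8 (Step 2)] -/
theorem exists_transversal {D₀ D₁ : ℕ} (hD₀ : 1 ≤ D₀) (hD₁ : 1 ≤ D₁) (W : Submodule ℂ (ℂ × (Fin n → ℂ))) :
    ∃ (c : ℕ) (w : Fin (finrank ℂ W - finrank ℂ ↥(W ⊓ (toConnAlgSubgroup H₀ hirr).tangent)) → ℂ × (Fin n → ℂ))
      (g : Fin (finrank ℂ W - finrank ℂ ↥(W ⊓ (toConnAlgSubgroup H₀ hirr).tangent)) → MvPolynomial (Fin (n + 1)) ℂ),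
      (∀ i, w i ∈ W) ∧ (∀ j, g j ∈ vanishing (σ • (H₀ : Set (GaGm n)))) ∧
      (∀ j, g j ∈ Box (n := n) D₀ D₁ c) ∧
      (∀ i j, i ≠ j → invDeriv (w i) (g j) ∈ vanishing (σ • (H₀ : Set (GaGm n)))) ∧
      (∀ i, invDeriv (w i) (g i) ∉ vanishing (σ • (H₀ : Set (GaGm n)))) := by
  classical
  set K := toConnAlgSubgroup H₀ hirr with hK
  set 𝔭 := vanishing (σ • (H₀ : Set (GaGm n))) with h𝔭
  have h𝔭ne : 𝔭 ≠ ⊤ := vanishing_ne_top ⟨σ, (mem_smul_coset_iff H₀ σ).mpr ⟨1, H₀.one_mem, by simp⟩⟩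
  -- the linear forms on `W`
  let ℓ₀ : ↥W →ₗ[ℂ] ℂ := (LinearMap.fst ℂ ℂ (Fin n → ℂ)).comp W.subtype
  let ℓ : (Fin n → ℤ) → (↥W →ₗ[ℂ] ℂ) := fun χ => (charForm χ).comp W.subtype
  let 𝓛 : Set (↥W →ₗ[ℂ] ℂ) := {l | (l = ℓ₀ ∧ K.addPart = false) ∨ ∃ χ ∈ K.chars, l = ℓ χ}
  set T : Submodule ℂ ↥W := K.tangent.comap W.subtype with hT
  have hTmem : ∀ v : ↥W, v ∈ T ↔ ∀ l ∈ 𝓛, l v = 0 := by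
    intro v
    rw [hT, Submodule.mem_comap, Submodule.coe_subtype, ConnAlgSubgroup.tangent, Submodule.mem_prod]
    constructor
    · rintro ⟨h1, h2⟩ l hl
      rcases hl with ⟨rfl, hadd⟩ | ⟨χ, hχ, rfl⟩
      · rw [hadd] at h1
        simpa [ℓ₀] using h1
      · exact h2 χ hχ
    · intro h
      refine ⟨?_, fun χ hχ => h (ℓ χ) (Or.inr ⟨χ, hχ, rfl⟩)⟩
      cases hadd : K.addPart
      · have := h ℓ₀ (Or.inl ⟨rfl, hadd⟩)
        simpa [ℓ₀] using this
      · simp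
  have hTrank : finrank ℂ T = finrank ℂ ↥(W ⊓ K.tangent) := by
    have e : T = (W ⊓ K.tangent).comap W.subtype := by
      rw [hT, Submodule.comap_inf, Submodule.comap_subtype_self, top_inf_eq]
    rw [e]
    exact (Submodule.comapSubtypeEquivOfLe (inf_le_left : W ⊓ K.tangent ≤ W)).finrank_eq
  have hs : (finrank ℂ W - finrank ℂ ↥(W ⊓ K.tangent)) + finrank ℂ T ≤ finrank ℂ ↥W := by
    rw [hTrank]
    have := Submodule.finrank_mono (inf_le_left : W ⊓ K.tangent ≤ W)
    omega
  obtain ⟨lam, v, hlam, hdual⟩ := exists_dual_family 𝓛 T hTmem _ hs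
  -- the equations attached to the chosen forms
  have hdata : ∀ j, ∃ (gj Uj : MvPolynomial (Fin (n + 1)) ℂ), gj ∈ 𝔭 ∧ Uj ∉ 𝔭 ∧
      ∀ u : ↥W, invDeriv (u : ℂ × (Fin n → ℂ)) gj - (lam j u) • Uj ∈ 𝔭 := by
    intro j
    rcases hlam j with ⟨hj, hadd⟩ | ⟨χ, hχ, hj⟩
    · refine ⟨X 0 - C (Multiplicative.toAdd σ.1), 1, X_sub_C_mem_vanishing H₀ hirr σ hadd,
        fun h => h𝔭ne ((Ideal.eq_top_iff_one _).mpr h), fun u => ?_⟩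
      rw [hj, map_sub, invDeriv_X_zero, invDeriv_C, sub_zero]
      simp [ℓ₀, MvPolynomial.smul_eq_C_mul]
    · have hχ' : χ ∈ charGroup (H₀ : Set (GaGm n)) := hχ
      refine ⟨charBinomial χ ((∏ j, (σ.2 j) ^ (χ j) : ℂˣ) : ℂ), ∏ j, X j.succ ^ (χ j).toNat,
        charBinomial_mem_vanishing H₀ σ hχ', prod_X_pow_notMem_vanishing H₀ σ _, fun u => ?_⟩
      rw [hj, show ℓ χ u = charForm χ (u : ℂ × (Fin n → ℂ)) from rfl, invDeriv_charBinomial_sub_eq,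
        MvPolynomial.smul_eq_C_mul]
      exact 𝔭.mul_mem_left _ (charBinomial_mem_vanishing H₀ σ hχ')
  choose g U hg hU hD using hdata
  refine ⟨Finset.univ.sup fun j => (g j).totalDegree, fun i => (v i : ℂ × (Fin n → ℂ)), g,
    fun i => (v i).2, hg, fun j => Box_mono (Finset.le_sup (Finset.mem_univ j)) (mem_Box_totalDegree hD₀ hD₁ _),
    fun i j hij => ?_, fun i => ?_⟩
  · have h := hD j (v i)
    rw [hdual i j, if_neg hij, zero_smul, sub_zero] at h
    exact h
  · intro hmem
    have h := hD i (v i)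
    rw [hdual i i, if_pos rfl, one_smul] at h
    exact hU i (by simpa using 𝔭.sub_mem hmem h)

end Transversal

end GaGm

end Literature.NumberTheory.Transcendental
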